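import Literature.NumberTheory.EllipticCurves.RootNumber
import Literature.NumberTheory.EllipticCurves.AtkinLehnerInvolutions
import HarnessLib

/-!
# Local root numbers of `E / ℚ` and Atkin–Lehner eigenvalues of its newform (Kellock–Dokchitser
2023, Remark 2.2) — the deep per-prime input of `w(E) = −∏_p w_p(E)`

The local product formula `WeierstrassCurve.frickeEigenvalue_eq_finprod_localRootNumberAt`
(`RootNumberProductFormulaProofs`: for the newform `f` of an elliptic `W / ℚ` with no additive
reduction above `2, 3`, `ε(f) = ∏ᶠ_v w_v(E)`) is, in print, the conjunction of

1. a **deep per-prime statement** — Kellock–Dokchitser, *Root numbers and parity phenomena*,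
   Bull. LMS 55 (2023), Remark 2.2 (PDF p. 7 of the held copy `paper:arxiv-2303.07883`): "For an
   elliptic curve defined over `ℚ`, the local root number at a prime `p` agrees with the eigenvalue
   of the associated Atkin–Lehner involution for the associated modular form. This follows from the
   corresponding statement for modular forms (see [Schmidt 2002] Theorem 3.2.2, for example)
   together with the local Langlands conjecture for `GL₂` and the modularity of elliptic curves
   over `ℚ`" — vendored here as the named fact
   `WeierstrassCurve.atkinLehnerEigenvalueAt_eq_localRootNumberAt`, statable now that the tree has
   the Atkin–Lehner involutions `w_{Q_p}` and their eigenvalues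
   (`Literature.NumberTheory.EllipticCurves.AtkinLehnerInvolutions`); and
2. **classical Atkin–Lehner theory** — `ε(f) = ∏_{p ∣ N} λ(Q_p)` (Knapp 1993, Thm. 9.27(c); the
   named fact `IsNewform0.frickeEigenvalue_eq_prod_atkinLehnerEigenvalueAt`) and `w_v(E) = 1` at the
   good places `v ∤ N_E` (Rohrlich; `localRootNumberAt_of_hasGoodReductionAt` with
   `conductorExponent_eq_zero_iff`).

The sibling `RootNumberAtkinLehnerProofs` proves the local product formula, and hence
`rootNumber_eq_algebraicRootNumber`, from 1, 2 and modularity. At a prime `p ∥ N_E` (multiplicative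
reduction) statement 1 is itself classical: `λ(p) = −a_p(f)` (Knapp 1993, Thm. 9.27, proved in
`AtkinLehnerInvolutionsProofs`) and `a_p(E) = 1, −1` for split, non-split reduction, matching
Rohrlich's `w_p = −1, +1`; the genuinely deep content is at the additive primes `p² ∣ N_E`.

## Statement conventions

* The fact is stated for the newform `f ∈ S₂(Γ₀(N_W))` of `W` at level the conductor
  `N_W = W.conductorNorm ℤ` (`IsNewformOf W f`, `[NeZero N_W]` as in `existsUnique_isNewformOf` and
  `frickeEigenvalue_eq_finprod_localRootNumberAt`), for the primes `p ∣ N_W` (where an Atkin–Lehner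
  involution "at `p`" is classically defined; at `p ∤ N_W` both sides are `1` by classical facts),
  the place of `ℤ` under `p` being `primesEquiv.symm p` (Mathlib `Rat.HeightOneSpectrum.primesEquiv`).
* The tree's `localRootNumber` carries the documented junk value `0` at additive places of residue
  characteristic `2, 3` (Halberstadt's tables are not transcribed, `RootNumber.lean`), so the fact
  carries, at the prime `p` in question, the same guard as `rootNumber_eq_algebraicRootNumber`:
  additive reduction at `v_p` only if `ringChar (ℤ/v_p) = p > 3`.
* `atkinLehnerEigenvalueAt f p = λ(Q_p)`, `Q_p = p^{v_p(N_W)}`, is the eigenvalue of Knapp's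
  `det^{k/2}`-normalised involution `w_{Q_p}` (`atkinLehnerInvolutionAt`), for which `λ = ±1`
  (Knapp 1993, Thm. 9.27(b)); this is the normalisation of Kellock–Dokchitser's remark
  ("eigenvalue of the Atkin–Lehner involution", a sign).

## References

* [KellockDokchitser2023] L. Cowland Kellock, V. Dokchitser, *Root numbers and parity phenomena*,
  Bull. Lond. Math. Soc. 55 (2023), 2557–2597, Rem. 2.2, Thm. 2.3, Cor. 2.4 (PDF pp. 7–8).
* [Schmidt2002JRMS] R. Schmidt, *Some remarks on local newforms for `GL(2)`*, J. Ramanujan Math.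
  Soc. 17 (2002), 115–147, Thm. 3.2.2 (not held).
* [Knapp1993] A. W. Knapp, *Elliptic curves*, Math. Notes 40 (1993), Thm. 9.27.
* [Rohrlich1994CRM] D. Rohrlich, *Elliptic curves and the Weil–Deligne group*, CRM Proc. Lecture
  Notes 4 (1994), 125–157, §§19–20 (not held; acquisition requested).
* [DeligneAntwerpII1973] P. Deligne, *Les constantes des équations fonctionnelles des fonctions L*,
  Antwerp II, LNM 349 (1973).
-/

noncomputable section

open scoped MatrixGroups

open CongruenceSubgroup Literature.NumberTheory.EllipticCurves.ModularForms IsDedekindDomain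

namespace WeierstrassCurve

variable (W : WeierstrassCurve ℚ)

/-- **The local root number of `E / ℚ` at `p ∣ N_E` is the Atkin–Lehner eigenvalue at `p` of its
newform** (Kellock–Dokchitser 2023, Remark 2.2, PDF p. 7: "For an elliptic curve defined over `ℚ`,
the local root number at a prime `p` agrees with the eigenvalue of the associated Atkin–Lehner
involution for the associated modular form. This follows from the corresponding statement for
modular forms ([Schmidt 2002] Theorem 3.2.2) together with the local Langlands conjecture for `GL₂`
and the modularity of elliptic curves over `ℚ`"). For an elliptic `W / ℚ`, `f ∈ S₂(Γ₀(N_W))` its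
newform (`IsNewformOf W f`: `aₙ(f) = aₙ(W)`), and a prime `p ∣ N_W = W.conductorNorm ℤ`:
`λ(Q_p)(f) = w_p(E)`, where `λ(Q_p) = atkinLehnerEigenvalueAt f p` is the eigenvalue of the
Atkin–Lehner involution `w_{Q_p}`, `Q_p = p^{v_p(N_W)}` (Knapp 1993, Thm. 9.27(b): `= ±1`), and
`w_p(E) = W.localRootNumberAt v_p` is Rohrlich's local root number at the place `v_p` of `ℤ` under
`p` (Kellock–Dokchitser 2023, Thm. 2.3 / Cor. 2.4; Rohrlich 1993, Prop. 2), which in the tree is the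
documented junk value `0` at an additive place above `2, 3` — whence the guard `h23` (additive
reduction at `v_p` only if `p > 3`), exactly that of `rootNumber_eq_algebraicRootNumber`. At
`p ∥ N_W` the statement is classical (`λ(p) = −a_p(f)`, Knapp 1993 Thm. 9.27, and `a_p(E) = ±1`
at split/non-split multiplicative reduction); its deep content is at the additive primes.
[cite: KellockDokchitser2023, Rem. 2.2] [cite: Knapp1993, Thm. 9.27] -/
def atkinLehnerEigenvalueAt_eq_localRootNumberAt : Prop :=
  ∀ [W.IsElliptic] [NeZero (W.conductorNorm ℤ)]
    {f : CuspForm (Gamma0 (W.conductorNorm ℤ)) 2} (_hf : IsNewformOf W f) (p : Nat.Primes)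
    (_hp : (p : ℕ) ∣ W.conductorNorm ℤ)
    (_h23 : W.HasAdditiveReductionAt ((Rat.HeightOneSpectrum.primesEquiv (R := ℤ)).symm p) →
      3 < ringChar (ℤ ⧸ ((Rat.HeightOneSpectrum.primesEquiv (R := ℤ)).symm p).asIdeal)),
    atkinLehnerEigenvalueAt f p =
      (W.localRootNumberAt ((Rat.HeightOneSpectrum.primesEquiv (R := ℤ)).symm p) : ℂ)

end WeierstrassCurve

end
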